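import Mathlib
import Summits.ResolutionOfSingularities.ResolutionOfSingularities.Theorems.WeightedInvariantLocalWeightedDropPolyDescentNewton
import Summits.ResolutionOfSingularities.ResolutionOfSingularities.Theorems.WeightedInvariantLocalWeightedDropWildMonicWCleanProcess
import Summits.ResolutionOfSingularities.ResolutionOfSingularities.Theorems.WeightedInvariantLocalWeightedDropWildMonicSCleanMonoShift

/-!
# `WeightedInvariant.LocalWeightedDrop`, stub S3ρ: the monic polyhedron descent — the SUPPORT OF A MONOMIAL RE-CENTRING of a tuple: centre point,
# segments, locality, weight minima (piece ρ-P `stub_polyPrep`, HALF A «dissolution step», part 1)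

Crux item stmt-ResolutionOfSingularities-8899 `LocalWeightedDrop` (route `ResolutionOfSingularities/WeightedInvariant`), registered skeleton v30
(09f812eb3be8b7d8), stub S3ρ `stub_wildMonicSurfaceReductionWon`; line «monic polyhedron descent» (res-L1-w43-lead-1,
`L/res-L1-w43-lead-1/g3/poly_descent_line_v1.lean` 905148e143a15d9b), named stub (ρ-P) `PolyDescent.stub_polyPrep` (every position admits a
well-preparing re-centring; lead res-type-061, CUT 2026-08-27T08:23:14Z: HALF A = this file + `…PolyDescentDissolve`, HALF B = `…PolyDescentPrepSeq` /
`…PolyDescentPrepExists`).  [OURS · L1 W4.3, chain w43, stub worker 2 (gen 3) as (ρ-P) second hand; (A1) = res-D-pv-058's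
`WildMonicPolyhedronShiftSegment.draft` VERBATIM (re-keyed to this namespace, with thanks); MODEL: Hironaka's vertex preparation, Cossart–Jannsen–Saito
LNM 2270 Ch. 8, for `J = (y^d + Σ_{j<d} A_j y^j)`; TEMPLATE: lead-1's degree-2 `…MonicDescentDissolve`; nothing here is a statement of any manuscript.]

For a tuple `A : Fin d → k[[u₁,u₂]]`, a lattice point `v` and a scalar `c`, the re-centring `y ↦ y + c·u^v` is `WildMonic.shift d A (monomial v c)`;
`P_v = d!·v` is the scaled centre point.
* (A1) `exists_of_coeff_shift_monomial_ne_zero`, `mem_newtonSet_shift_monomial` (every new Newton point is `P_v` or lies on a segment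
  `(d−j)·Q = (d−i)·P + (i−j)·P_v` from an old point `P`), `le_map_of_mem_newtonSet_shift_monomial`, `lt_map_of_mem_newtonSet_shift_monomial`;
* tools: `vertexCoeff_factorial_smul` (the vertex coefficient of slot `i` at `P_v` is `[u^{(d−i)v}]A_i`), `sub_lt_sum_of_isPosT`;
* (A2) `coeff_shift_monomial_of_not_le` — coefficients at exponents `f` with `¬ v ≤ f` are untouched (LOCALITY);
* (A5) `le_weight_of_mem_newtonSet_shift_monomial` — weight minima never drop.
-/

set_option linter.dupNamespace false -- mandated namespace of this single-conjunct summit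

noncomputable section

namespace Summit.ResolutionOfSingularities.ResolutionOfSingularities.Theorems

namespace PolyDescent

open MvPowerSeries MonicDescent WildMonic Literature.RingTheory.TwoVariableSeries

variable {k : Type} [Field k]

/-! ## (A1) The support of a monomial re-centring: centre point and segments (res-D-pv-058) -/

/-- **Support of the re-centred tuple by a monomial.**  If `[u^e](shift d A (c u^v))_j ≠ 0` then, for some `n ≤ d − j`, `n·v ≤ e` and either
`n + j < d` and `e − n·v` is an exponent of `A_{n+j}`, or `n + j = d` and `e = n·v`. -/
theorem exists_of_coeff_shift_monomial_ne_zero {d : ℕ} (A : Fin d → MvPowerSeries (Fin 2) k) (v : Fin 2 →₀ ℕ) (c : k) (j : Fin d)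
    {e : Fin 2 →₀ ℕ} (he : coeff e (shift d A (monomial v c) j) ≠ 0) :
    ∃ n : ℕ, n • v ≤ e ∧ ((∃ i : Fin d, (i : ℕ) = n + j ∧ coeff (e - n • v) (A i) ≠ 0) ∨ (n + (j : ℕ) = d ∧ e = n • v)) := by
  classical
  rw [shift_eq_sum, map_sum] at he
  obtain ⟨n, hn, hne⟩ := Finset.exists_ne_zero_of_sum_ne_zero he
  rw [Finset.mem_range] at hn
  rw [mul_assoc, ← nsmul_eq_mul, map_nsmul] at hne
  have hne' : coeff e ((monicPoly d A).coeff (n + (j : ℕ)) * (monomial v c) ^ n) ≠ 0 := fun h0 => hne (by rw [h0, smul_zero])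
  rw [monomial_pow, coeff_mul_monomial] at hne'
  by_cases hle : n • v ≤ e
  · rw [if_pos hle] at hne'
    have hB : coeff (e - n • v) ((monicPoly d A).coeff (n + (j : ℕ))) ≠ 0 := left_ne_zero_of_mul hne'
    refine ⟨n, hle, ?_⟩
    by_cases hdj : n + (j : ℕ) = d
    · right
      refine ⟨hdj, ?_⟩
      rw [hdj, coeff_monicPoly_self, coeff_one] at hB
      have h0 : e - n • v = 0 := by by_contra h; exact hB (if_neg h)
      exact le_antisymm (by
        intro l
        have := congrArg (fun f => f l) h0
        simp only [Finsupp.coe_tsub, Pi.sub_apply, Finsupp.coe_zero, Pi.zero_apply] at this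
        omega) hle
    · left
      have hlt : n + (j : ℕ) < d := by omega
      refine ⟨⟨n + (j : ℕ), hlt⟩, rfl, ?_⟩
      rwa [show (monicPoly d A).coeff (n + (j : ℕ)) = A ⟨n + (j : ℕ), hlt⟩ from coeff_monicPoly_of_lt d A ⟨n + (j : ℕ), hlt⟩] at hB
  · rw [if_neg hle] at hne'
    exact absurd rfl hne'

/-- **Every Newton point of the re-centred tuple is the centre point `d!·v` or lies on a segment from an old Newton point to `d!·v`**:
`(d−j)·Q = (d−i)·P + (i−j)·(d!·v)` with `P ∈ N(A)`, `j ≤ i < d`  (Hironaka's vertex preparation: the new points of `Δ` lie on the segments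
joining the old points to the vertex). -/
theorem mem_newtonSet_shift_monomial {d : ℕ} (A : Fin d → MvPowerSeries (Fin 2) k) (v : Fin 2 →₀ ℕ) (c : k) {Q : Fin 2 →₀ ℕ}
    (hQ : Q ∈ newtonSet (shift d A (monomial v c))) :
    Q = d.factorial • v ∨ ∃ (i j : Fin d) (P : Fin 2 →₀ ℕ), (j : ℕ) ≤ i ∧ P ∈ newtonSet A ∧
      (d - (j : ℕ)) • Q = (d - (i : ℕ)) • P + ((i : ℕ) - j) • (d.factorial • v) := by
  obtain ⟨j, e, he, rfl⟩ := hQ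
  obtain ⟨n, hnv, hcase⟩ := exists_of_coeff_shift_monomial_ne_zero A v c j he
  rcases hcase with ⟨i, hi, ha⟩ | ⟨hnd, rfl⟩
  · right
    refine ⟨i, j, slotWeight d i • (e - n • v), by omega, ⟨i, e - n • v, ha, rfl⟩, ?_⟩
    have he' : e = (e - n • v) + n • v := (tsub_add_cancel_of_le hnv).symm
    rw [smul_smul, smul_smul, smul_smul, mul_comm (d - (j : ℕ)), slotWeight_mul_sub j, mul_comm (d - (i : ℕ)), slotWeight_mul_sub i,
      show (i : ℕ) - j = n by omega]
    conv_lhs => rw [he']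
    rw [smul_add, smul_smul, mul_comm]
  · left
    rw [smul_smul, show slotWeight d j * n = d.factorial by rw [show n = d - (j : ℕ) by omega]; exact slotWeight_mul_sub j]

/-- **Lower bounds by additive functionals persist under a monomial re-centring**: if `m ≤ L P` on the Newton set of `A` and `m ≤ L (d!·v)`, then
`m ≤ L Q` on the Newton set of `shift d A (c u^v)` (degree `2`: `MonicDescent.weight_dissolve_ge`, `lowerBound_dissolve`). -/
theorem le_map_of_mem_newtonSet_shift_monomial {d : ℕ} (A : Fin d → MvPowerSeries (Fin 2) k) (v : Fin 2 →₀ ℕ) (c : k)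
    (L : (Fin 2 →₀ ℕ) →+ ℕ) (m : ℕ) (hA : ∀ P ∈ newtonSet A, m ≤ L P) (hv : m ≤ L (d.factorial • v))
    {Q : Fin 2 →₀ ℕ} (hQ : Q ∈ newtonSet (shift d A (monomial v c))) : m ≤ L Q := by
  rcases mem_newtonSet_shift_monomial A v c hQ with rfl | ⟨i, j, P, hji, hP, hseg⟩
  · exact hv
  · have hj := j.2
    have h1 := congrArg L hseg
    rw [map_nsmul, map_add, map_nsmul, map_nsmul, smul_eq_mul, smul_eq_mul, smul_eq_mul] at h1
    have h2 : (d - (j : ℕ)) * m ≤ (d - (j : ℕ)) * L Q := by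
      rw [h1]
      calc (d - (j : ℕ)) * m = (d - (i : ℕ)) * m + ((i : ℕ) - j) * m := by rw [← add_mul]; congr 1; omega
        _ ≤ (d - (i : ℕ)) * L P + ((i : ℕ) - j) * L (d.factorial • v) :=
          add_le_add (Nat.mul_le_mul_left _ (hA P hP)) (Nat.mul_le_mul_left _ hv)
    exact Nat.le_of_mul_le_mul_left h2 (by omega)

/-- **Strict lower bounds persist away from the centre point**: if `m < L P` on the Newton set of `A` and `m ≤ L (d!·v)`, then `m < L Q` for every
Newton point `Q ≠ d!·v` of `shift d A (c u^v)` (what happens AT `d!·v` is the solvability of the vertex — not treated here). -/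
theorem lt_map_of_mem_newtonSet_shift_monomial {d : ℕ} (A : Fin d → MvPowerSeries (Fin 2) k) (v : Fin 2 →₀ ℕ) (c : k)
    (L : (Fin 2 →₀ ℕ) →+ ℕ) (m : ℕ) (hA : ∀ P ∈ newtonSet A, m < L P) (hv : m ≤ L (d.factorial • v))
    {Q : Fin 2 →₀ ℕ} (hQ : Q ∈ newtonSet (shift d A (monomial v c))) (hQv : Q ≠ d.factorial • v) : m < L Q := by
  rcases mem_newtonSet_shift_monomial A v c hQ with rfl | ⟨i, j, P, hji, hP, hseg⟩
  · exact absurd rfl hQv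
  · have hj := j.2
    have hi := i.2
    have h1 := congrArg L hseg
    rw [map_nsmul, map_add, map_nsmul, map_nsmul, smul_eq_mul, smul_eq_mul, smul_eq_mul] at h1
    have h2 : (d - (j : ℕ)) * m < (d - (j : ℕ)) * L Q := by
      rw [h1]
      calc (d - (j : ℕ)) * m = (d - (i : ℕ)) * m + ((i : ℕ) - j) * m := by rw [← add_mul]; congr 1; omega
        _ < (d - (i : ℕ)) * L P + ((i : ℕ) - j) * L (d.factorial • v) :=
          add_lt_add_of_lt_of_le (Nat.mul_lt_mul_of_pos_left (hA P hP) (by omega)) (Nat.mul_le_mul_left _ hv)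
    exact Nat.lt_of_mul_lt_mul_left h2

/-! ## Small tools -/

/-- the two letters. -/
private theorem two_cases : ∀ l : Fin 2, l = 0 ∨ l = 1 := by decide

/-- `v ≤ n • v` for `n ≥ 1`. -/
theorem le_smul_of_pos (v : Fin 2 →₀ ℕ) {n : ℕ} (hn : 0 < n) : v ≤ n • v := by
  intro l
  rw [Finsupp.smul_apply, smul_eq_mul]
  exact Nat.le_mul_of_pos_left _ hn

/-- `(a • v) − (b • v) = (a − b) • v`. -/
theorem smul_tsub_smul (v : Fin 2 →₀ ℕ) (a b : ℕ) : a • v - b • v = (a - b) • v := by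
  refine finsupp_fin2_ext ?_ ?_ <;>
  · simp only [Finsupp.tsub_apply, Finsupp.smul_apply, smul_eq_mul]
    rw [Nat.sub_mul]

/-- `P_v = d!·v` is the slot-`i` scaling of `(d−i)·v`. -/
theorem factorial_smul_eq_slotWeight_smul {d : ℕ} (i : Fin d) (v : Fin 2 →₀ ℕ) :
    d.factorial • v = slotWeight d i • ((d - (i : ℕ)) • v) := by
  rw [smul_smul, slotWeight_mul_sub']

/-- The vertex coefficient of slot `i` AT THE CENTRE `P_v` is the coefficient of `A_i` at `(d−i)·v`. -/
theorem vertexCoeff_factorial_smul {d : ℕ} (A : Fin d → MvPowerSeries (Fin 2) k) (v : Fin 2 →₀ ℕ) (i : Fin d) :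
    vertexCoeff d A (d.factorial • v) i = coeff ((d - (i : ℕ)) • v) (A i) := by
  rw [factorial_smul_eq_slotWeight_smul i v, vertexCoeff_smul]

/-- For a position every exponent `e` of `A_i` has `e₀ + e₁ > d − i`. -/
theorem sub_lt_sum_of_isPosT {d : ℕ} {A : Fin d → MvPowerSeries (Fin 2) k} (hA : IsPosT d A) (i : Fin d) {e : Fin 2 →₀ ℕ}
    (he : coeff e (A i) ≠ 0) : d - (i : ℕ) < e 0 + e 1 := by
  by_contra hle
  push Not at hle
  apply he
  apply coeff_of_lt_order
  refine lt_of_le_of_lt ?_ (hA i)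
  have hdeg : Finsupp.degree e = e 0 + e 1 := by rw [Finsupp.degree_eq_sum]; simp [Fin.sum_univ_two]
  rw [hdeg]; exact_mod_cast hle

/-! ## (A2) Locality: exponents not above `v` are untouched -/

/-- **LOCALITY**: a coefficient at an exponent `f` with `¬ v ≤ f` is unchanged by the re-centring `y ↦ y + c·u^v`. -/
theorem coeff_shift_monomial_of_not_le {d : ℕ} (A : Fin d → MvPowerSeries (Fin 2) k) (v : Fin 2 →₀ ℕ) (c : k) (j : Fin d)
    {f : Fin 2 →₀ ℕ} (hf : ¬ v ≤ f) : coeff f (shift d A (monomial v c) j) = coeff f (A j) := by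
  classical
  rw [coeff_shift_monomial]
  have hj := j.2
  have hfirst : ¬ f = (d - (j : ℕ)) • v := by
    intro h
    exact hf (h ▸ le_smul_of_pos v (by omega))
  rw [if_neg hfirst, zero_add, Finset.sum_eq_single j]
  · rw [Nat.sub_self, zero_smul, if_pos (show (0 : Fin 2 →₀ ℕ) ≤ _ from fun l => Nat.zero_le _), Nat.choose_self, Nat.cast_one, pow_zero, one_mul, one_mul, tsub_zero]
  · intro i _ hij
    by_cases hlt : (i : ℕ) < j
    · rw [Nat.choose_eq_zero_of_lt hlt, Nat.cast_zero, zero_mul, zero_mul, ite_self]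
    · have hgt : (j : ℕ) < i := lt_of_le_of_ne (not_lt.mp hlt) (fun h => hij (Fin.ext h).symm)
      rw [if_neg]
      intro hle
      exact hf ((le_smul_of_pos v (by omega)).trans hle)
  · intro h; exact absurd (Finset.mem_univ j) h

/-! ## (A5) Weight minima never drop -/

/-- **WEIGHT MINIMA NEVER DROP** under a monomial re-centring whose centre respects the bound. -/
theorem le_weight_of_mem_newtonSet_shift_monomial {d : ℕ} (A : Fin d → MvPowerSeries (Fin 2) k) (v : Fin 2 →₀ ℕ) (c : k)
    (w : Fin 2 → ℕ) (m : ℕ) (hA : ∀ P ∈ newtonSet A, m ≤ Finsupp.weight w P) (hv : m ≤ Finsupp.weight w (d.factorial • v))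
    {Q : Fin 2 →₀ ℕ} (hQ : Q ∈ newtonSet (shift d A (monomial v c))) : m ≤ Finsupp.weight w Q :=
  le_map_of_mem_newtonSet_shift_monomial A v c (Finsupp.weight w) m hA hv hQ

end PolyDescent

end Summit.ResolutionOfSingularities.ResolutionOfSingularities.Theorems

end
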